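import Literature.Barriers.SmoothPoincare4.ExoticContractibleSymmetryKillingProofs
import Literature.AlgebraicTopology.SingularHomology.RelFundamentalClassModTwo
import Literature.AlgebraicTopology.SingularHomology.SuspensionIsomorphism
import Literature.AlgebraicTopology.SingularHomology.LocalHomology
import HarnessLib

/-!
# The boundary of a compact contractible manifold is connected; Akbulut–Ruberman's symmetry-killing cobordism from Lemma 2.3 and the Claim alone

Fourth-level sibling proof file of `Literature/Barriers/SmoothPoincare4/ExoticContractible.lean`,
under `ExoticContractibleSymmetryKillingProofs.lean`. That file reduces the named fact
`Literature.Barriers.SmoothPoincare4.akbulutRuberman2016_symmetryKillingCobordism` (Akbulut–Ruberman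
2016, §3 ¶1 with the Claim) to an inline "geometric core" consisting of (a) the connectedness of
`∂W` for every compact contractible smooth 4-manifold `W` and (b) the outputs of Lemma 2.3 and of
the Claim of §3 (an invertible cobordism `X` from `∂W` to a closed `N` with the extension property,
`∂W → X` a homology isomorphism and `π₁`-onto). Part (a) is not 3-manifold topology but
Poincaré–Lefschetz duality — in Akbulut–Ruberman's setting "`M = ∂W`" is a homology sphere, the
boundary of a cork — and the tree's singular homology library now proves everything needed.
This file PROVES (a) and restates the reduction with (b) alone:

* `Literature.Barriers.SmoothPoincare4.connectedSpace_boundaryCarrier_of_contractibleSpace` —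
  **the boundary of a compact contractible topological manifold of dimension `≥ 2` is nonempty
  and connected** (for every boundary datum `b`, `ConnectedSpace b.carrier`). Proof: by
  Lefschetz duality mod 2 (Spanier 1966, Thm. 6.3.12; Hatcher 2002, Thm. 3.43; tree theorem
  `bijective_relCapProduct_relFundamentalClassModTwo`, valid for every compact Hausdorff space
  with a half-space atlas) `H_q(W, ∂W; ℤ/2) ≅ Hⁿ⁺²⁻q(W; ℤ/2) = 0` for `q ≤ n + 1`
  (`isZero_relativeSingularHomology_boundary_of_contractibleSpace`), so by the exact sequence
  of the pair `H₀(∂W; ℤ/2) → H₀(W; ℤ/2) ≅ ℤ/2` is an isomorphism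
  (`isIso_singularHomologyMap_boundary_zero_of_contractibleSpace`); hence `∂W ≠ ∅`, and `∂W` is path connected
  because a locally path-connected space whose `H₀(-; ℤ/2)` has at most one nonzero class is
  path connected (`pathConnectedSpace_of_forall_singularHomology_zero_eq`, Hatcher Prop. 2.6/2.7).
* `Literature.Barriers.SmoothPoincare4.akbulutRuberman2016_symmetryKillingCobordism_of_geometricCore`
  — the named fact from (b) alone: for every compact contractible `W` there are a closed
  3-manifold `N ≠ ∅` and a cobordism `X` from `∂W` to `N`, invertible, with the extension
  property of the Claim, with `∂W → X` an isomorphism on `H_*(-; ℤ)` and onto on `π₁`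
  (Akbulut–Ruberman 2016, Lemma 2.3 with Cor. 2.5 and Prop. 2.6, and the Claim of §3). No new
  named fact is introduced (D-0026); everything else in the printed proof of this leaf is now
  formal.
* `Literature.Barriers.SmoothPoincare4.akbulutRuberman2016_symmetryKillingCobordism_of_homologyCobordism`
  — the same reduction with the two data conditions on `N` (compact, nonempty) REMOVED: they
  follow from invertibility alone. In a composite `Y = X ∪_N X′` (`Cobordism.IsComposite`) the
  far end `N` of `X` is compact, being homeomorphic (via `X.inr`) to the preimage under the
  embedding `X.W → Y.W` of the compact image of `X′.W` (`compactSpace_of_isComposite`); and if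
  moreover `Y ≅ M × [0, 1]` with `M` connected and nonempty (`Cobordism.IsTrivialRelEnds`), then
  `N ≠ ∅`, for otherwise the images of `X.W` and `X′.W` would disconnect `Y.W`
  (`nonempty_of_isInvertible`). The remaining inline hypothesis is now word for word the
  quantifier prefix of the named fact with its clause (iii) replaced by the two homological
  conclusions of Lemma 2.3 ("homology cobordism", "induces an isomorphism on fundamental
  groups" — surjectivity suffices).

## References

* S. Akbulut, D. Ruberman, *Absolutely exotic compact 4-manifolds*, Comment. Math. Helv. 91
  (2016) 1–19 = arXiv:1410.1461v3, Lemma 2.3 and §3 (proof of Thm. A). [AkbulutRuberman2016]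
* A. Hatcher, *Algebraic Topology*, CUP (2002), Prop. 2.6, Prop. 2.7, Thm. 2.16, §3.3 p. 235,
  Thm. 3.43. [HatcherAT2002]
* E. H. Spanier, *Algebraic Topology* (1966; Springer 1981), Ch. 6 §3, Cor. 8 and Thm. 12.
  [Spanier1981]
-/

noncomputable section

open scoped Manifold ContDiff Topology unitInterval ContinuousMap
open Function Set CategoryTheory CategoryTheory.Limits
open Literature.Topology.FourManifolds Literature.AlgebraicTopology.Homotopy
  Literature.AlgebraicTopology.SingularHomology

namespace Literature.Barriers.SmoothPoincare4

universe u v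

/-- Local notation: `𝔼 n` is the model Euclidean space `EuclideanSpace ℝ (Fin n)`. -/
local notation "𝔼 " n:arg => EuclideanSpace ℝ (Fin n)

/-- Local notation: `ℍ n` is the closed half space `EuclideanHalfSpace n`. -/
local notation "ℍ " n:arg => EuclideanHalfSpace n

/-! ### `H₀` with `ℤ/2` coefficients and path components -/

section HZero

variable {Z : Type u} [TopologicalSpace Z]

/-- In `H₀(Z; ℤ/2)` of a path-connected space any two nonzero classes are equal (`ε` is an
isomorphism onto `ℤ/2`, Hatcher 2002, Prop. 2.7). [cite: HatcherAT2002, Prop. 2.7] -/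
theorem singularHomology_zero_eq_of_ne_zero [PathConnectedSpace Z]
    {x y : singularHomology (ZMod 2) (ZMod 2) Z 0} (hx : x ≠ 0) (hy : y ≠ 0) : x = y := by
  haveI := singularHomology.isIso_ε_of_pathConnectedSpace (ZMod 2) (ZMod 2) (X := Z)
  have hinj : Function.Injective (singularHomology.ε (ZMod 2) (ZMod 2) Z) :=
    (ModuleCat.mono_iff_injective _).mp inferInstance
  have h1 : ∀ u : singularHomology (ZMod 2) (ZMod 2) Z 0, u ≠ 0 →
      singularHomology.ε (ZMod 2) (ZMod 2) Z u = ULift.up 1 := by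
    intro u hu
    have hne : singularHomology.ε (ZMod 2) (ZMod 2) Z u ≠ 0 := fun h =>
      hu (hinj (by rw [h, map_zero]))
    apply ULift.ext
    have hd : (singularHomology.ε (ZMod 2) (ZMod 2) Z u).down ≠ 0 := fun h =>
      hne (ULift.ext _ _ h)
    have h01 : ∀ a : ZMod 2, a ≠ 0 → a = 1 := by decide
    exact h01 _ hd
  exact hinj ((h1 x hx).trans (h1 y hy).symm)

/-- **A locally path-connected nonempty space whose `H₀(-; ℤ/2)` has at most one nonzero class
is path connected** (Hatcher 2002, Prop. 2.6: `H₀` is the direct sum over the path components,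
each contributing a copy of `ℤ/2` by Prop. 2.7). Proof: if the (clopen) path component `C` of a
point had nonempty complement, then `Z ≅ C ⊔ Cᶜ` and the classes of a point of `C` and of a point
of `Cᶜ` would be two distinct nonzero classes. [cite: HatcherAT2002, Prop. 2.6 and Prop. 2.7] -/
theorem pathConnectedSpace_of_forall_singularHomology_zero_eq [LocallyPathConnectedSpace Z]
    [Nonempty Z]
    (h : ∀ x y : singularHomology (ZMod 2) (ZMod 2) Z 0, x ≠ 0 → y ≠ 0 → x = y) :
    PathConnectedSpace Z := by
  classical
  let z₀ : Z := Classical.arbitrary Z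
  let C : Set Z := pathComponent z₀
  have hC : IsClopen C := IsClopen.pathComponent _
  suffices hCu : C = univ by
    rw [pathConnectedSpace_iff_univ, ← hCu]
    exact isPathConnected_pathComponent
  by_contra hne
  obtain ⟨q, hq⟩ : (Cᶜ : Set Z).Nonempty := by
    rw [Set.nonempty_compl]
    exact hne
  let e : (↥C ⊕ ↥Cᶜ) ≃ₜ Z := homeomorphSumCompl hC
  haveI : PathConnectedSpace ↥C :=
    isPathConnected_iff_pathConnectedSpace.1 isPathConnected_pathComponent
  -- a nonzero class on `C`
  haveI := singularHomology.isIso_ε_of_pathConnectedSpace (ZMod 2) (ZMod 2) (X := ↥C)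
  let bC : singularHomology (ZMod 2) (ZMod 2) (↥C) 0 :=
    inv (singularHomology.ε (ZMod 2) (ZMod 2) ↥C) (ULift.up 1)
  have hbC : singularHomology.ε (ZMod 2) (ZMod 2) (↥C) bC = ULift.up 1 := by
    show (inv (singularHomology.ε (ZMod 2) (ZMod 2) ↥C) ≫
      singularHomology.ε (ZMod 2) (ZMod 2) ↥C) (ULift.up 1) = ULift.up 1
    rw [IsIso.inv_hom_id]
    rfl
  have hbC0 : bC ≠ 0 := by
    intro h0
    rw [h0, map_zero] at hbC
    exact absurd (congrArg ULift.down hbC) (by decide)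
  -- a nonzero class on `Cᶜ`: push `bC` forward along the constant map at `q`
  let cq : C(↥C, ↥Cᶜ) := ContinuousMap.const ↥C ⟨q, hq⟩
  let bq : singularHomology (ZMod 2) (ZMod 2) (↥Cᶜ) 0 := singularHomology.map (ZMod 2) (ZMod 2) cq 0 bC
  have hbq0 : bq ≠ 0 := by
    intro h0
    have h1 : singularHomology.ε (ZMod 2) (ZMod 2) (↥Cᶜ) bq = ULift.up 1 := by
      show (singularHomology.map (ZMod 2) (ZMod 2) cq 0 ≫
        singularHomology.ε (ZMod 2) (ZMod 2) (↥Cᶜ)) bC = ULift.up 1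
      rw [singularHomology.map_ε]
      exact hbC
    rw [h0, map_zero] at h1
    exact absurd (congrArg ULift.down h1) (by decide)
  -- the two classes in `Z`
  have hinje : Function.Injective (singularHomology.map (ZMod 2) (ZMod 2)
      (e : C(↥C ⊕ ↥Cᶜ, Z)) 0) :=
    (ModuleCat.mono_iff_injective _).mp
      (inferInstanceAs (Mono (singularHomology.mapIso (ZMod 2) (ZMod 2) e 0).hom))
  let x : singularHomology (ZMod 2) (ZMod 2) Z 0 := singularHomology.map (ZMod 2) (ZMod 2)
    (e : C(↥C ⊕ ↥Cᶜ, Z)) 0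
      (singularHomology.map (ZMod 2) (ZMod 2) (SingularSimplex.sumInl ↥C ↥Cᶜ) 0 bC)
  let y : singularHomology (ZMod 2) (ZMod 2) Z 0 := singularHomology.map (ZMod 2) (ZMod 2)
    (e : C(↥C ⊕ ↥Cᶜ, Z)) 0
      (singularHomology.map (ZMod 2) (ZMod 2) (SingularSimplex.sumInr ↥C ↥Cᶜ) 0 bq)
  have hx : x ≠ 0 := by
    intro h0
    apply hbC0
    apply singularHomology.map_inl_injective (X := ↥C) (Y := ↥Cᶜ) 0
    apply hinje
    rw [map_zero, map_zero]
    exact h0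
  have hy : y ≠ 0 := by
    intro h0
    apply hbq0
    apply singularHomology.map_inr_injective (X := ↥C) (Y := ↥Cᶜ) 0
    apply hinje
    rw [map_zero, map_zero]
    exact h0
  have hxy : singularHomology.map (ZMod 2) (ZMod 2) (SingularSimplex.sumInl ↥C ↥Cᶜ) 0 bC =
      singularHomology.map (ZMod 2) (ZMod 2) (SingularSimplex.sumInr ↥C ↥Cᶜ) 0 bq :=
    hinje (h x y hx hy)
  have hzero := (singularHomology.map_inl_add_map_inr_eq_zero_iff 0 bC (-bq)).mp
    (by rw [map_neg, hxy, add_neg_cancel])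
  exact hbC0 hzero.1

end HZero

/-! ### The exact sequence of the pair in one degree -/

section Pair

variable (R : Type v) [CommRing R] {X : Type u} [TopologicalSpace X]

/-- **Exact sequence of the pair, degree `n`** (Hatcher 2002, Thm. 2.16): if `Hₙ₊₁(X, A) = 0` and
`Hₙ(X, A) = 0` then `A ↪ X` induces an isomorphism on `Hₙ` (in
`Hₙ₊₁(X, A) →∂ Hₙ(A) →i Hₙ(X) →j Hₙ(X, A)` the outer groups vanish). The all-degrees version over
`ℤ` is the tree's `isIso_singularHomologyMap_subtypeVal_of_isZero_relativeSingularHomology`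
(`HCobordismWall.lean`). [cite: HatcherAT2002, §2.1 Thm. 2.16 (exact sequence of the pair)] -/
theorem isIso_singularHomologyMap_subsetIncl_of_isZero (A : Set X) (n : ℕ)
    (h₁ : IsZero (relativeSingularHomology R R X A (n + 1)))
    (h₀ : IsZero (relativeSingularHomology R R X A n)) :
    IsIso (singularHomology.map R R (subsetIncl A) n) := by
  have hmono : Mono (singularHomology.map R R (subsetIncl A) n) :=
    (relativeSingularHomology.exact_δ_map R R A n).mono_g (h₁.eq_of_src _ _)
  have hepi : Epi (singularHomology.map R R (subsetIncl A) n) :=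
    (relativeSingularHomology.exact_map_ofAbsolute R R A n).epi_f (h₀.eq_of_tgt _ _)
  exact isIso_of_mono_of_epi _

end Pair

/-! ### The boundary of a compact contractible manifold -/

section Boundary

variable {n : ℕ} {W : Type u} [TopologicalSpace W] [T2Space W] [CompactSpace W]
  [ChartedSpace (ℍ (n + 2)) W]

/-- **`H_q(W, ∂W; ℤ/2) = 0` for `q ≤ n + 1` when the compact `(n+2)`-manifold `W` is
contractible**: by Lefschetz duality mod 2 (Spanier 1966, Thm. 6.3.12; Hatcher 2002, Thm. 3.43;
tree theorem `bijective_relCapProduct_relFundamentalClassModTwo`, for every compact Hausdorff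
space with an atlas on the half-space) `a ↦ a ⌢ [W, ∂W]₂ : Hᵖ(W; ℤ/2) → H_q(W, ∂W; ℤ/2)` is a
bijection for `p + q = n + 2`, and `Hᵖ(W; ℤ/2) = 0` for `p ≥ 1` (`W` contractible).
[cite: HatcherAT2002, §3.3 Thm. 3.43] [cite: Spanier1981, Ch. 6 Sec. 3 Thm. 12] -/
theorem isZero_relativeSingularHomology_boundary_of_contractibleSpace [ContractibleSpace W]
    {q : ℕ} (hq : q ≤ n + 1) :
    IsZero (relativeSingularHomology (ZMod 2) (ZMod 2) W ((𝓡∂ (n + 2)).boundary W) q) := by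
  have hpq : (n + 2 - q) + q = (n + 1) + 1 := by omega
  have hbij := bijective_relCapProduct_relFundamentalClassModTwo (n := n + 1) (W := W) hpq
  have hp : IsZero (singularCohomology (ZMod 2) (ZMod 2) W (n + 2 - q)) :=
    isZero_singularCohomology_of_contractibleSpace (ZMod 2) (ZMod 2) W (by omega)
  haveI : Subsingleton (singularCohomology (ZMod 2) (ZMod 2) W (n + 2 - q)) :=
    ModuleCat.subsingleton_of_isZero hp
  haveI : Subsingleton
      (relativeSingularHomology (ZMod 2) (ZMod 2) W ((𝓡∂ (n + 2)).boundary W) q) := by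
    refine ⟨fun z z' => ?_⟩
    obtain ⟨a, rfl⟩ := hbij.2 z
    obtain ⟨a', rfl⟩ := hbij.2 z'
    rw [Subsingleton.elim a a']
  exact ModuleCat.isZero_of_subsingleton _

/-- **`H₀(∂W; ℤ/2) → H₀(W; ℤ/2)` is an isomorphism for a compact contractible manifold of
dimension `≥ 2`** (`H₁(W, ∂W; ℤ/2) = H₀(W, ∂W; ℤ/2) = 0` and the exact sequence of the pair).
[cite: HatcherAT2002, §2.1 Thm. 2.16 and §3.3 Thm. 3.43] -/
theorem isIso_singularHomologyMap_boundary_zero_of_contractibleSpace [ContractibleSpace W] :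
    IsIso (singularHomology.map (ZMod 2) (ZMod 2) (subsetIncl ((𝓡∂ (n + 2)).boundary W)) 0) := by
  have h₁ : IsZero (relativeSingularHomology (ZMod 2) (ZMod 2) W ((𝓡∂ (n + 2)).boundary W) (0 + 1)) :=
    isZero_relativeSingularHomology_boundary_of_contractibleSpace (n := n) (W := W) (q := 0 + 1)
      (by omega)
  have h₀ : IsZero (relativeSingularHomology (ZMod 2) (ZMod 2) W ((𝓡∂ (n + 2)).boundary W) 0) :=
    isZero_relativeSingularHomology_boundary_of_contractibleSpace (n := n) (W := W) (q := 0)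
      (Nat.zero_le _)
  exact isIso_singularHomologyMap_subsetIncl_of_isZero (ZMod 2) (X := W)
    ((𝓡∂ (n + 2)).boundary W) 0 h₁ h₀

/-- **The boundary of a compact contractible topological manifold of dimension `≥ 2` is nonempty
and connected** — for every boundary datum `b` of `W` (`BoundaryData`, a manifold `b.carrier`
embedded onto `∂W`), `b.carrier` is a connected (in particular nonempty) space. This is the
elementary part of "the boundary of a compact contractible manifold is a homology sphere"
(Poincaré–Lefschetz duality; Kervaire–Milnor 1963, proof of Lemma 2.3; for Akbulut–Ruberman's
Thm. B, `M = ∂W` is the boundary of a cork): `H₀(∂W; ℤ/2) ≅ H₀(W; ℤ/2) ≅ ℤ/2` via the inclusion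
(`isIso_singularHomologyMap_boundary_zero_of_contractibleSpace`), so `∂W ≠ ∅` and, `∂W` being
locally path connected, `∂W` is path connected
(`pathConnectedSpace_of_forall_singularHomology_zero_eq`). Dimension `≥ 2` is needed (`W = [0, 1]`).
[cite: HatcherAT2002, §3.3 Thm. 3.43 and Prop. 2.7] -/
theorem connectedSpace_boundaryCarrier_of_contractibleSpace [ContractibleSpace W]
    (b : BoundaryData (𝓡∂ (n + 2)) W (𝓡 (n + 1))) : ConnectedSpace b.carrier := by
  set B : Set W := (𝓡∂ (n + 2)).boundary W with hB
  haveI hiso := isIso_singularHomologyMap_boundary_zero_of_contractibleSpace (n := n) (W := W)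
  -- the boundary datum as the composite of a homeomorphism onto `∂W` and the inclusion
  let eB : b.carrier ≃ₜ ↥B :=
    b.isSmoothEmbedding.isEmbedding.toHomeomorph.trans (Homeomorph.setCongr b.range_incl)
  let ι : C(b.carrier, W) := ⟨b.incl, b.continuous_incl⟩
  have hfac : ι = (subsetIncl B).comp (eB : C(b.carrier, ↥B)) := by
    ext x
    exact (b.isSmoothEmbedding.isEmbedding.toHomeomorph_apply_coe x).symm
  haveI hisoι : IsIso (singularHomology.map (ZMod 2) (ZMod 2) ι 0) := by
    rw [hfac, singularHomology.map_comp]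
    haveI : IsIso (singularHomology.map (ZMod 2) (ZMod 2) (eB : C(b.carrier, ↥B)) 0) :=
      (singularHomology.mapIso (ZMod 2) (ZMod 2) eB 0).isIso_hom
    infer_instance
  have hinj : Function.Injective (singularHomology.map (ZMod 2) (ZMod 2) ι 0) :=
    (ModuleCat.mono_iff_injective _).mp inferInstance
  have hsurj : Function.Surjective (singularHomology.map (ZMod 2) (ZMod 2) ι 0) :=
    (ModuleCat.epi_iff_surjective _).mp inferInstance
  -- a nonzero class of `H₀(W; ℤ/2)`
  haveI := singularHomology.isIso_ε_of_pathConnectedSpace (ZMod 2) (ZMod 2) (X := W)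
  let u : singularHomology (ZMod 2) (ZMod 2) W 0 :=
    inv (singularHomology.ε (ZMod 2) (ZMod 2) W) (ULift.up 1)
  have hu : singularHomology.ε (ZMod 2) (ZMod 2) W u = ULift.up 1 := by
    show (inv (singularHomology.ε (ZMod 2) (ZMod 2) W) ≫
      singularHomology.ε (ZMod 2) (ZMod 2) W) (ULift.up 1) = ULift.up 1
    rw [IsIso.inv_hom_id]
    rfl
  have hu0 : u ≠ 0 := by
    intro h0
    rw [h0, map_zero] at hu
    exact absurd (congrArg ULift.down hu) (by decide)
  -- `∂W ≠ ∅`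
  haveI : Nonempty b.carrier := by
    by_contra hemp
    rw [not_nonempty_iff] at hemp
    have hz : IsZero (singularHomology (ZMod 2) (ZMod 2) b.carrier 0) :=
      (isZero_csingularHomology_of_isEmpty (ZMod 2) (ZMod 2) (X := b.carrier) 0).of_iso
        (csingularHomology.compIso (ZMod 2) (ZMod 2) b.carrier 0).symm
    obtain ⟨v, hv⟩ := hsurj u
    have hv0 : v = 0 := (ModuleCat.subsingleton_of_isZero hz).elim _ _
    rw [hv0, map_zero] at hv
    exact hu0 hv.symm
  -- `∂W` is path connected
  haveI : LocallyPathConnectedSpace b.carrier :=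
    ChartedSpace.locallyPathConnectedSpace (𝔼 (n + 1)) b.carrier
  haveI : PathConnectedSpace b.carrier := by
    refine pathConnectedSpace_of_forall_singularHomology_zero_eq fun x y hx hy => hinj ?_
    refine singularHomology_zero_eq_of_ne_zero (fun h0 => hx (hinj ?_)) (fun h0 => hy (hinj ?_))
    · rw [h0, map_zero]
    · rw [h0, map_zero]
  infer_instance

end Boundary

/-! ### The named fact from Lemma 2.3 and the Claim alone -/

/-- **Akbulut–Ruberman's symmetry-killing cobordism (named fact
`akbulutRuberman2016_symmetryKillingCobordism`) from its geometric core proper.** The hypothesis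
is the output of the 3-manifold topology of the printed proof (Akbulut–Ruberman 2016, §3 ¶1),
stated inline: for every compact contractible smooth 4-manifold `W` with boundary datum `b`
there are a CLOSED 3-manifold `N ≠ ∅` and a cobordism `X` from `∂W` to `N` which is invertible
(Lemma 2.3: "`X` is an invertible homology cobordism from `M` to a 3-manifold `N`"), has the
extension property of the Claim of §3 (`FarEndDiffeosExtend`: "every element [of `π₀ Diff(N)`]
extends over the cobordism `X` in such a way that it is isotopic to the identity on `M`"), and
whose near end `∂W → X` is an isomorphism on integral homology (Lemma 2.3, "homology
cobordism") and onto on `π₁` (Lemma 2.3: "the inclusion `M → X` induces an isomorphism on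
fundamental groups"). Compared with `akbulutRuberman2016_symmetryKillingCobordism_of_core`
(`ExoticContractibleSymmetryKillingProofs.lean`) the connectedness of `∂W` is no longer assumed:
it is `connectedSpace_boundaryCarrier_of_contractibleSpace`. What remains unproved of the named
fact is exactly this inline hypothesis — Lemma 2.3 with Cor. 2.5 (hyperbolic links with trivial
symmetry group, after Paoluzzi–Porti and Myers), Prop. 2.6 (the doubly slice knot `11n42`,
computer-certified) and the Claim (JSJ decompositions, Waldhausen) — for which neither Mathlib
nor the tree has vocabulary; no new named fact is introduced (D-0026).
[cite: AkbulutRuberman2016, §3 (proof of Thm. A, first paragraph and Claim) and Lemma 2.3] -/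
theorem akbulutRuberman2016_symmetryKillingCobordism_of_geometricCore
    (hcore : ∀ (W : Type u) [TopologicalSpace W] [T2Space W] [SecondCountableTopology W]
      [ChartedSpace (ℍ 4) W] [IsManifold (𝓡∂ 4) ∞ W] [CompactSpace W] [ContractibleSpace W]
      (b : BoundaryData (𝓡∂ 4) W (𝓡 3)),
      ∃ (N : Type u) (_ : TopologicalSpace N) (_ : ChartedSpace (𝔼 3) N) (_ : IsManifold (𝓡 3) ∞ N)
        (_ : CompactSpace N) (_ : Nonempty N) (X : Cobordism 3 b.carrier N),
        X.IsInvertible ∧ FarEndDiffeosExtend X ∧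
        (∀ k, IsIso (singularHomology.map ℤ ℤ (⟨X.inl, X.continuous_inl⟩ : C(b.carrier, X.W)) k)) ∧
        (∀ x : b.carrier, Function.Surjective
          (FundamentalGroup.map (⟨X.inl, X.continuous_inl⟩ : C(b.carrier, X.W)) x))) :
    akbulutRuberman2016_symmetryKillingCobordism.{u} :=
  akbulutRuberman2016_symmetryKillingCobordism_of_core fun W _ _ _ _ _ _ _ b =>
    ⟨connectedSpace_boundaryCarrier_of_contractibleSpace (n := 2) b, hcore W b⟩

/-! ### The far end of an invertible cobordism is closed and nonempty -/

section FarEnd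

variable {n : ℕ} {M N P : Type u} [TopologicalSpace M] [ChartedSpace (𝔼 n) M]
  [TopologicalSpace N] [ChartedSpace (𝔼 n) N] [TopologicalSpace P] [ChartedSpace (𝔼 n) P]

/-- **The middle manifold of a composite cobordism is compact.** If `Y = X ∪_N X′`
(`Cobordism.IsComposite`), then `N` is compact: `X.inr` is an embedding whose range is the
preimage, under the embedding `j : X.W → Y.W`, of the compact image `j′(X′.W)` (the two pieces
meet exactly along `N`). (For a bare `Cobordism n M N` nothing forces `N` to be compact when
`M ≠ ∅`.) [cite: MilnorHCobordism1965, §1, Thm. 1.4 and Def. 1.5] -/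
theorem compactSpace_of_isComposite {Y : Cobordism n M P} {X : Cobordism n M N}
    {X' : Cobordism n N P} (h : Y.IsComposite X X') : CompactSpace N := by
  obtain ⟨j, j', hj, hj', -, hR, -, -⟩ := h
  have h1 : range X.inr = j ⁻¹' range j' := by
    ext x
    constructor
    · rintro ⟨y, rfl⟩
      exact ⟨X'.inl y, ((hR _ _).2 ⟨y, rfl, rfl⟩).symm⟩
    · rintro ⟨x', hx'⟩
      obtain ⟨y, hy, -⟩ := (hR x x').1 hx'.symm
      exact ⟨y, hy.symm⟩
  have h2 : IsCompact (range X.inr) := by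
    rw [h1]
    exact ((isCompact_range hj'.isEmbedding.continuous).isClosed.preimage
      hj.isEmbedding.continuous).isCompact
  refine ⟨?_⟩
  rw [X.isSmoothEmbedding_inr.isEmbedding.isCompact_iff, image_univ]
  exact h2

/-- **The far end of an invertible cobordism from a connected nonempty manifold is nonempty.**
If `X ∪_N X′ ≅ M × [0, 1]` (`Cobordism.IsInvertible`, Akbulut–Ruberman 2016, Def. 2.1) with `M`
connected and nonempty, then `N ≠ ∅`: otherwise the images of `X.W ∋ inl m` and `X′.W ∋ inr m`
would be disjoint nonempty closed sets covering the connected space `M × [0, 1]`.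
[cite: AkbulutRuberman2016, Def. 2.1] -/
theorem nonempty_of_isInvertible [ConnectedSpace M] {X : Cobordism n M N} (h : X.IsInvertible) :
    Nonempty N := by
  obtain ⟨X', Y, ⟨j, j', hj, hj', hU, hR, hl, hr⟩, Φ, -, -⟩ := h
  by_contra hN
  rw [not_nonempty_iff] at hN
  obtain ⟨m⟩ := (inferInstance : Nonempty M)
  -- `Y.W ≅ M × [0, 1]` is connected
  haveI : ConnectedSpace (Set.Icc (0 : ℝ) 1) :=
    isConnected_iff_connectedSpace.1 (isConnected_Icc zero_le_one)
  haveI : ConnectedSpace Y.W := Φ.toHomeomorph.connectedSpace_iff.2 inferInstance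
  -- the two pieces are disjoint closed sets covering `Y.W`
  have hdisj : Disjoint (range j) (range j') := by
    rw [Set.disjoint_left]
    rintro _ ⟨x, rfl⟩ ⟨x', hx'⟩
    obtain ⟨y, -, -⟩ := (hR x x').1 hx'.symm
    exact isEmptyElim y
  have hcompl : (range j)ᶜ = range j' := by
    refine Subset.antisymm (fun p hp => ?_) fun p hp hp' => Set.disjoint_left.1 hdisj hp' hp
    have hpU : p ∈ range j ∪ range j' := hU ▸ mem_univ p
    exact hpU.resolve_left hp
  have hclopen : IsClopen (range j) := by
    refine ⟨(isCompact_range hj.isEmbedding.continuous).isClosed, ?_⟩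
    rw [← compl_compl (range j), hcompl, isOpen_compl_iff]
    exact (isCompact_range hj'.isEmbedding.continuous).isClosed
  rcases isClopen_iff.1 hclopen with h0 | h1
  · have hm : Y.inl m ∈ range j := ⟨X.inl m, hl m⟩
    rw [h0] at hm
    exact hm
  · have hm : Y.inr m ∈ range j' := ⟨X'.inr m, hr m⟩
    have hm' : Y.inr m ∈ range j := h1 ▸ mem_univ _
    exact Set.disjoint_left.1 hdisj hm' hm

end FarEnd

/-! ### The named fact from an invertible homology cobordism with the extension property -/

/-- **Akbulut–Ruberman's symmetry-killing cobordism (named fact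
`akbulutRuberman2016_symmetryKillingCobordism`) from an invertible homology cobordism with the
extension property of the Claim.** For every compact contractible smooth 4-manifold `W` with
boundary datum `b`, SUPPOSE there are a smooth 3-manifold `N` and a cobordism `X` from `∂W` to
`N` which is invertible (Def. 2.1), has the extension property of the Claim of §3
(`FarEndDiffeosExtend X`), and whose near end `∂W → X` is an isomorphism on `H_*(-; ℤ)` and onto
on `π₁` — the printed output of Lemma 2.3 ("`X` is an invertible homology cobordism from `M` to
a 3-manifold `N` … the inclusion `M → X` induces an isomorphism on fundamental groups") for the
link of Cor. 2.5 and the concordances of Prop. 2.6, together with the Claim. THEN the named fact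
holds: clause (iii) ("Since `V` and `V′` are simply connected homology balls, they are
contractible") is `contractibleSpace_of_cobordismAttachment_of_surjective`, the connectedness
of `∂W` is `connectedSpace_boundaryCarrier_of_contractibleSpace`, and `N` is automatically
closed and nonempty (`compactSpace_of_isComposite`, `nonempty_of_isInvertible`). The hypothesis
has exactly the quantifier prefix of the named fact, with (iii) replaced by the two homological
conclusions of Lemma 2.3; it is what remains unproved (hyperbolic links with trivial symmetry
group after Paoluzzi–Porti and Myers, the doubly slice knot `11n42`, JSJ decompositions and
Waldhausen — no vocabulary in Mathlib or the tree). No new named fact is introduced (D-0026).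
[cite: AkbulutRuberman2016, §3 (proof of Thm. A, first paragraph and Claim) and Lemma 2.3] -/
theorem akbulutRuberman2016_symmetryKillingCobordism_of_homologyCobordism
    (hcore : ∀ (W : Type u) [TopologicalSpace W] [T2Space W] [SecondCountableTopology W]
      [ChartedSpace (ℍ 4) W] [IsManifold (𝓡∂ 4) ∞ W] [CompactSpace W] [ContractibleSpace W]
      (b : BoundaryData (𝓡∂ 4) W (𝓡 3)),
      ∃ (N : Type u) (_ : TopologicalSpace N) (_ : ChartedSpace (𝔼 3) N) (_ : IsManifold (𝓡 3) ∞ N)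
        (X : Cobordism 3 b.carrier N),
        X.IsInvertible ∧ FarEndDiffeosExtend X ∧
        (∀ k, IsIso (singularHomology.map ℤ ℤ (⟨X.inl, X.continuous_inl⟩ : C(b.carrier, X.W)) k)) ∧
        (∀ x : b.carrier, Function.Surjective
          (FundamentalGroup.map (⟨X.inl, X.continuous_inl⟩ : C(b.carrier, X.W)) x))) :
    akbulutRuberman2016_symmetryKillingCobordism.{u} := by
  refine akbulutRuberman2016_symmetryKillingCobordism_of_geometricCore ?_
  intro W _ _ _ _ _ _ _ b
  obtain ⟨N, tN, cN, mN, X, hInv, hFar, hH, hP⟩ := hcore W b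
  haveI : ConnectedSpace b.carrier :=
    connectedSpace_boundaryCarrier_of_contractibleSpace (n := 2) b
  obtain ⟨X', Y, hC, hT⟩ := hInv
  have hcN : CompactSpace N := compactSpace_of_isComposite hC
  have hnN : Nonempty N := nonempty_of_isInvertible ⟨X', Y, hC, hT⟩
  exact ⟨N, tN, cN, mN, hcN, hnN, X, ⟨X', Y, hC, hT⟩, hFar, hH, hP⟩

end Literature.Barriers.SmoothPoincare4

end
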